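import Mathlib.MeasureTheory.Measure.Haar.Unique
import Mathlib.Analysis.Normed.Operator.LinearIsometry
import Literature.AnabelianGeometry.AbsoluteAnabelian.MonoAnalyticLogShells
import Literature.AnabelianGeometry.AbsoluteAnabelian.LocalVolumesArchimedean
import Literature.IUT.LogThetaLattice.HolomorphicLogShells
import Literature.IUT.LogThetaLattice.ArchimedeanMetrics
import HarnessLib

/-!
# [IUTchIII] Proposition 1.2 (vii): the `{±1} × {±1}`-orbit of isomorphisms of archimedean mono-analytic
# log-shells — compatibility with the log-shell, the radial / angular log-volumes and the metrics
# (proof-only companion to `BiCores.lean`)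

Mochizuki, *Inter-universal Teichmüller Theory III*, kurims manuscript (May 2020), §1, Prop 1.2 (vii), p.32 l.−4 –
p.33 l.22 [claim: Mochizuki2012, status: disputed] (D-0012 claim key; record-only: the content typed here is
elementary real/complex analysis and measure theory on `S¹`; this file takes no side on anything).

Discharge-wave companion (abc-iut cell, block C / W6, cone of [IUTchIII] Cor 3.12, node `IUTchIII:Prop1.2(vii)`,
kernel id `N_IUTchIII_Prop1_2_vii`). Printed text (p.33 l.8–22, own render of the kurims PDF): "there is a natural
functorial algorithm … in the collection of data `†F^{⊢×μ}_v` for constructing a poly-isomorphism [i.e., an orbit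
of isomorphisms with respect to the independent actions of `{±1}` on each of the direct factors that occur in the
construction of [AbsTopIII], Proposition 5.8, (v)] `log(†D^⊢_v) ⥲ log(†F^{⊢×μ}_v)` of topological modules … as
well as a functorial algorithm … in the collection of data `†F_v` for constructing poly-isomorphisms [the same
orbits] `log(†D^⊢_v) ⥲ log(†F^{⊢×μ}_v) ⥲ log(†F_v)` … The various isomorphisms of the last two displays are
compatible with one another, as well as with the respective log-shells and the respective angular and radial
log-volumes on these log-shells."

Already in the tree for Prop 1.2 (vii) (abc-iut-L6-t3, `BiCores.lean` p406839): the strip-frame INTERFACE field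
`BiCoricData.monoFxm` (a nonempty, transport-stable poly-isomorphism, "a `{±1}`-orbit at `v ∈ V̲^{arc}`"),
`monoFxmOfF ⊆ monoFxm`, `fxmHol`, the PROVED frame theorems `monoHolAt'_nonempty`, `mem_monoHolAt'_iff`,
`monoHolAt'_subset_orbit` (`BiCoresProp12Proofs.lean`); the archimedean MODEL `arcLogShell = {‖a‖ ≤ π}`
(`LocalLogShells.lean`), the radial / angular log-volumes `ComplexVolume.radialLogVolume` / `angularLogVolume` of
[AbsTopIII] Prop 5.7 (ii) (abc-iut-L4-t3) and the metrics `Metric` of Rmk 1.2.1 (ii) (`ArchimedeanMetrics.lean`). What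
had NO decl (plan/L6/SUBDAG-IUTchIII-Prop-12.md row Prop-12.vii.r19: "the `{±1}²`-orbit as a concrete `PolyIso` at
`k = ℂ` is not a separate L6 decl") is the bracket "[an orbit of isomorphisms with respect to the independent
actions of `{±1}` on each of the direct factors]" and its compatibility clause. This file PROVES exactly that, twice:
* § 1, INTERFACE level of [AbsTopIII] Prop 5.8 (iv)(v) (abc-iut-L4-t3 `MonoAnalyticArch A`: `k~(G) := C~ × C~`,
  `ℐ(G) = {(a·x, b·x) | x ∈ ℐ_{C~}, a² + b² = 1}`, `𝒪^×_{k~(G)}`): the sign changes `(x, y) ↦ (u·x, v·y)`,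
  `u, v ∈ {±1} = ℤˣ`, compose as `ℤˣ × ℤˣ` by involutions (`prop12vii_signMap_comp`, `_one`, `_involutive`), map
  `ℐ(G)` and `𝒪^×_{k~(G)}` onto themselves (`prop12vii_signMap_image_logShell`, `_image_units`), hence leave the
  two log-volumes the interface pins (`MonoAnalyticArch.IsNormalized`) unchanged (`_radLogVol_logShell`,
  `_angLogVol_units`) — for EVERY output datum `A`, in particular the genuine one of `MonoAnalyticArchModelProofs`;
* § 2, the `ℂ`-MODEL `k~ = ℝ × ℝ ⥲ ℂ`, `(x, y) ↦ x + iy` (as in `MonoAnalyticArchModelProofs.lean`): the four sign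
  maps `z ↦ u·Re z + i·v·Im z` are `id`, `z ↦ -z`, `z ↦ z̄`, `z ↦ -z̄` (`prop12vii_signC_range`), each an `ℝ`-linear
  isometric automorphism of the topological module `ℂ` (`prop12vii_signC_exists_linearIsometryEquiv`), composing
  as `ℤˣ × ℤˣ` (`prop12vii_signC_comp`); each maps `I_k = arcLogShell = ComplexLogShell.logShell`,
  `O_k^× = arcUnits = ComplexLogShell.units`, `O_k = arcIntegers` onto themselves, preserves the radial volume /
  log-volume of EVERY subset and the class `M(k)` (`prop12vii_signC_radialVolume`, `_radialLogVolume`,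
  `_mem_radialAdmissible`), the angular volume / log-volume of every subset of `k^×` (`prop12vii_signC_angularVolume`,
  `_angularLogVolume`: rotation-by-`π` and reflection invariance of arc length on `S¹ = ℝ/2πℤ`, i.e. Mathlib's
  Haar-measure negation invariance) and every metric of Rmk 1.2.1 (ii) (`prop12vii_signC_metric`).
No new mathematics; no definition; no named fact. NOT here: the nonarchimedean `Ism`-orbit of Prop 1.2 (vi)
([IUTchII] Ex 1.8 (iv), owner abc-iut-L6-t1/L6-d2); anything about `BiCoricData.monoFxm` beyond `BiCores*.lean`.
-/

set_option autoImplicit false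

namespace Literature.IUT.LogThetaLattice

open Complex
open scoped ComplexConjugate Pointwise
open _root_.MeasureTheory
open Literature.AnabelianGeometry.AbsoluteAnabelian

universe u

/-- **IUTchIII:Prop1.2(vii)** (kurims p.33) the square of a sign `u ∈ {±1} = ℤˣ` is `1`. [claim: Mochizuki2012, status: disputed] -/
theorem prop12vii_intUnits_cast_sq (u : ℤˣ) : (((u : ℤ) : ℝ)) ^ 2 = 1 := by
  rcases Int.units_eq_one_or u with rfl | rfl <;> simp

/-! ### 1. Interface level: the sign changes on the two direct factors of `k~(G) = C~ × C~` ([AbsTopIII] Prop 5.8 (iv)(v)) -/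

section Interface

variable {M : TMMono.{u}} (A : MonoAnalyticArch M)

/-- **IUTchIII:Prop1.2(vii)** (kurims p.33; [AbsTopIII] Prop 5.8 (iv) p.140) on the real line `C~` a sign acts
through `ℝ`: `u·(a·x) = (±a)·x`. [claim: Mochizuki2012, status: disputed] -/
theorem prop12vii_units_smul_smul (u : ℤˣ) (a : ℝ) (x : A.cover) :
    u • a • x = (((u : ℤ) : ℝ) * a) • x := by
  rw [Units.smul_def, ← Int.cast_smul_eq_zsmul ℝ, smul_smul]

/-- **IUTchIII:Prop1.2(vii)** (kurims p.33) "the independent actions of `{±1}` on each of the direct factors" of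
`k~(G) = C~ × C~`: the sign changes `(x, y) ↦ (u·x, v·y)` compose as the group `{±1} × {±1}`.
[claim: Mochizuki2012, status: disputed] -/
theorem prop12vii_signMap_comp (u v u' v' : ℤˣ) :
    (Prod.map (u • ·) (v • ·) : A.shell → A.shell) ∘ (Prod.map (u' • ·) (v' • ·) : A.shell → A.shell) =
      (Prod.map ((u * u') • ·) ((v * v') • ·) : A.shell → A.shell) := by
  funext ⟨x, y⟩
  simp only [Function.comp_apply, Prod.map_apply, smul_smul]

/-- **IUTchIII:Prop1.2(vii)** (kurims p.33) the trivial signs act as the identity of `k~(G)`.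
[claim: Mochizuki2012, status: disputed] -/
theorem prop12vii_signMap_one :
    (Prod.map ((1 : ℤˣ) • ·) ((1 : ℤˣ) • ·) : A.shell → A.shell) = id := by
  funext ⟨x, y⟩
  simp only [Prod.map_apply, one_smul, id_eq]

/-- **IUTchIII:Prop1.2(vii)** (kurims p.33) every sign change of `k~(G)` is an involution (so the orbit of an
isomorphism under the sign changes consists of isomorphisms). [claim: Mochizuki2012, status: disputed] -/
theorem prop12vii_signMap_involutive (u v : ℤˣ) :
    Function.Involutive (Prod.map (u • ·) (v • ·) : A.shell → A.shell) := by
  rintro ⟨x, y⟩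
  simp only [Prod.map_apply, smul_smul, Int.units_mul_self, one_smul]

/-- **IUTchIII:Prop1.2(vii)** (kurims p.33; [AbsTopIII] Prop 5.8 (v) p.140) "compatible with … the respective
log-shells": every sign change of `k~(G) = C~ × C~` maps the log-shell
`ℐ(G) = {(a·x, b·x) | x ∈ ℐ_{C~}, a² + b² = 1}` onto itself. [claim: Mochizuki2012, status: disputed] -/
theorem prop12vii_signMap_image_logShell (u v : ℤˣ) :
    (Prod.map (u • ·) (v • ·) : A.shell → A.shell) '' A.logShell = A.logShell := by
  have key : ∀ u v : ℤˣ, (Prod.map (u • ·) (v • ·) : A.shell → A.shell) '' A.logShell ⊆ A.logShell := by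
    rintro u v _ ⟨_, ⟨a, b, x, hx, hab, rfl⟩, rfl⟩
    refine ⟨((u : ℤ) : ℝ) * a, ((v : ℤ) : ℝ) * b, x, hx, ?_, ?_⟩
    · rw [mul_pow, mul_pow, prop12vii_intUnits_cast_sq, prop12vii_intUnits_cast_sq, one_mul, one_mul, hab]
    · simp only [Prod.map_apply, prop12vii_units_smul_smul]
  refine (key u v).antisymm fun z hz => ?_
  exact ⟨Prod.map (u • ·) (v • ·) z, key u v ⟨z, hz, rfl⟩, prop12vii_signMap_involutive A u v z⟩

/-- **IUTchIII:Prop1.2(vii)** (kurims p.33; [AbsTopIII] Prop 5.8 (vi) p.141) every sign change of `k~(G)` maps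
`𝒪^×_{k~(G)} = {(a·x, b·x) | x ∈ ∂ℐ_{C~}, a² + b² = π⁻²}` onto itself. [claim: Mochizuki2012, status: disputed] -/
theorem prop12vii_signMap_image_units (u v : ℤˣ) :
    (Prod.map (u • ·) (v • ·) : A.shell → A.shell) '' A.units = A.units := by
  have key : ∀ u v : ℤˣ, (Prod.map (u • ·) (v • ·) : A.shell → A.shell) '' A.units ⊆ A.units := by
    rintro u v _ ⟨_, ⟨a, b, x, hx, hab, rfl⟩, rfl⟩
    refine ⟨((u : ℤ) : ℝ) * a, ((v : ℤ) : ℝ) * b, x, hx, ?_, ?_⟩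
    · rw [mul_pow, mul_pow, prop12vii_intUnits_cast_sq, prop12vii_intUnits_cast_sq, one_mul, one_mul, hab]
    · simp only [Prod.map_apply, prop12vii_units_smul_smul]
  refine (key u v).antisymm fun z hz => ?_
  exact ⟨Prod.map (u • ·) (v • ·) z, key u v ⟨z, hz, rfl⟩, prop12vii_signMap_involutive A u v z⟩

/-- **IUTchIII:Prop1.2(vii)** (kurims p.33; [AbsTopIII] Prop 5.8 (v) p.140) a sign maps the core segment
`ℐ_{C~}` ("invariant with respect to the action of `±1`") onto itself. [claim: Mochizuki2012, status: disputed] -/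
theorem prop12vii_sign_image_coreSeg (u : ℤˣ) : (u • ·) '' A.coreSeg = A.coreSeg := by
  have key : ∀ u : ℤˣ, (u • ·) '' A.coreSeg ⊆ A.coreSeg := by
    rintro u _ ⟨x, hx, rfl⟩
    rcases Int.units_eq_one_or u with rfl | rfl
    · simpa only [one_smul] using hx
    · simpa only [Units.neg_smul, one_smul] using A.neg_mem_coreSeg hx
  refine (key u).antisymm fun x hx => ⟨u • x, key u ⟨x, hx, rfl⟩, ?_⟩
  simp only [smul_smul, Int.units_mul_self, one_smul]

/-- **IUTchIII:Prop1.2(vii)** (kurims p.33) "compatible with … the respective … radial log-volumes on these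
log-shells": the radial log-volume `μ^log(G)` of the log-shell is unchanged by every sign change (the interface of
[AbsTopIII] Prop 5.8 (vi) pins `μ^log(G)` on `ℐ(G)`, cf. `MonoAnalyticArch.IsNormalized`).
[claim: Mochizuki2012, status: disputed] -/
theorem prop12vii_signMap_radLogVol_logShell (u v : ℤˣ) :
    A.radLogVol ((Prod.map (u • ·) (v • ·) : A.shell → A.shell) '' A.logShell) = A.radLogVol A.logShell := by
  rw [prop12vii_signMap_image_logShell]

/-- **IUTchIII:Prop1.2(vii)** (kurims p.33) "compatible with … the respective angular … log-volumes": the angular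
log-volume `μ̆^log(G)` of `𝒪^×_{k~(G)}` is unchanged by every sign change (cf. `MonoAnalyticArch.IsNormalized`).
[claim: Mochizuki2012, status: disputed] -/
theorem prop12vii_signMap_angLogVol_units (u v : ℤˣ) :
    A.angLogVol ((Prod.map (u • ·) (v • ·) : A.shell → A.shell) '' A.units) = A.angLogVol A.units := by
  rw [prop12vii_signMap_image_units]

end Interface

/-! ### 2. The `ℂ`-model `k~ = ℝ × ℝ ⥲ ℂ`, `(x, y) ↦ x + iy`: the four sign maps `z ↦ u·Re z + i·v·Im z` -/

section Model

/-- **IUTchIII:Prop1.2(vii)** (kurims p.33) under `ℂ ≅ ℝ × ℝ` (real and imaginary part = the two direct factors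
`C~ × C~` of [AbsTopIII] Prop 5.8 (iv)) the sign map `z ↦ u·Re z + i·v·Im z` IS the independent sign change
`(x, y) ↦ (u·x, v·y)` of § 1. [claim: Mochizuki2012, status: disputed] -/
theorem prop12vii_signC_equivRealProd (u v : ℤˣ) (z : ℂ) :
    equivRealProd (⟨u • z.re, v • z.im⟩ : ℂ) = Prod.map (u • ·) (v • ·) (equivRealProd z) := rfl

/-- **IUTchIII:Prop1.2(vii)** (kurims p.33) trivial signs: the identity. [claim: Mochizuki2012, status: disputed] -/
theorem prop12vii_signC_one_one (z : ℂ) : (⟨(1 : ℤˣ) • z.re, (1 : ℤˣ) • z.im⟩ : ℂ) = z := by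
  apply Complex.ext <;> simp

/-- **IUTchIII:Prop1.2(vii)** (kurims p.33) both signs `-1`: `z ↦ -z`. [claim: Mochizuki2012, status: disputed] -/
theorem prop12vii_signC_neg_neg (z : ℂ) : (⟨(-1 : ℤˣ) • z.re, (-1 : ℤˣ) • z.im⟩ : ℂ) = -z := by
  apply Complex.ext <;> simp

/-- **IUTchIII:Prop1.2(vii)** (kurims p.33) sign `-1` on the imaginary factor only: complex conjugation.
[claim: Mochizuki2012, status: disputed] -/
theorem prop12vii_signC_one_neg (z : ℂ) : (⟨(1 : ℤˣ) • z.re, (-1 : ℤˣ) • z.im⟩ : ℂ) = conj z := by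
  apply Complex.ext <;> simp

/-- **IUTchIII:Prop1.2(vii)** (kurims p.33) sign `-1` on the real factor only: `z ↦ -z̄`.
[claim: Mochizuki2012, status: disputed] -/
theorem prop12vii_signC_neg_one (z : ℂ) : (⟨(-1 : ℤˣ) • z.re, (1 : ℤˣ) • z.im⟩ : ℂ) = -conj z := by
  apply Complex.ext <;> simp

/-- **IUTchIII:Prop1.2(vii)** (kurims p.33) "an orbit of isomorphisms with respect to the independent actions of
`{±1}` on each of the direct factors": in the `ℂ`-model the orbit of the identity consists of exactly the four maps
`id`, `z ↦ -z`, `z ↦ z̄`, `z ↦ -z̄`. [claim: Mochizuki2012, status: disputed] -/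
theorem prop12vii_signC_range :
    Set.range (fun uv : ℤˣ × ℤˣ => fun z : ℂ => (⟨uv.1 • z.re, uv.2 • z.im⟩ : ℂ)) =
      {id, (fun z => -z), (fun z => conj z), (fun z => -conj z)} := by
  apply Set.Subset.antisymm
  · rintro _ ⟨⟨u, v⟩, rfl⟩
    rcases Int.units_eq_one_or u with rfl | rfl <;> rcases Int.units_eq_one_or v with rfl | rfl
    · exact Or.inl (funext prop12vii_signC_one_one)
    · exact Or.inr (Or.inr (Or.inl (funext prop12vii_signC_one_neg)))
    · exact Or.inr (Or.inr (Or.inr (funext prop12vii_signC_neg_one)))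
    · exact Or.inr (Or.inl (funext prop12vii_signC_neg_neg))
  · rintro f (rfl | rfl | rfl | rfl)
    · exact ⟨(1, 1), funext prop12vii_signC_one_one⟩
    · exact ⟨(-1, -1), funext prop12vii_signC_neg_neg⟩
    · exact ⟨(1, -1), funext prop12vii_signC_one_neg⟩
    · exact ⟨(-1, 1), funext prop12vii_signC_neg_one⟩

/-- **IUTchIII:Prop1.2(vii)** (kurims p.33) the sign maps compose as the group `{±1} × {±1}` ("independent
actions"). [claim: Mochizuki2012, status: disputed] -/
theorem prop12vii_signC_comp (u v u' v' : ℤˣ) (z : ℂ) :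
    (⟨u • (⟨u' • z.re, v' • z.im⟩ : ℂ).re, v • (⟨u' • z.re, v' • z.im⟩ : ℂ).im⟩ : ℂ) =
      ⟨(u * u') • z.re, (v * v') • z.im⟩ := by
  apply Complex.ext <;> simp only [smul_smul]

/-- **IUTchIII:Prop1.2(vii)** (kurims p.33) every sign map is an involution of `ℂ`. [claim: Mochizuki2012, status: disputed] -/
theorem prop12vii_signC_involutive (u v : ℤˣ) :
    Function.Involutive fun z : ℂ => (⟨u • z.re, v • z.im⟩ : ℂ) := by
  intro z
  apply Complex.ext <;> simp only [smul_smul, Int.units_mul_self, one_smul]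

/-- **IUTchIII:Prop1.2(vii)** (kurims p.33) "poly-isomorphism … of topological modules": each of the four sign maps
is (the underlying map of) an `ℝ`-linear isometric automorphism of `ℂ` — `1`, `-1`, `conjLIE`, `-conjLIE`.
[claim: Mochizuki2012, status: disputed] -/
theorem prop12vii_signC_exists_linearIsometryEquiv (u v : ℤˣ) :
    ∃ e : ℂ ≃ₗᵢ[ℝ] ℂ, ∀ z : ℂ, e z = ⟨u • z.re, v • z.im⟩ := by
  rcases Int.units_eq_one_or u with rfl | rfl <;> rcases Int.units_eq_one_or v with rfl | rfl
  · exact ⟨LinearIsometryEquiv.refl ℝ ℂ, fun z => by rw [prop12vii_signC_one_one]; rfl⟩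
  · exact ⟨conjLIE, fun z => by rw [prop12vii_signC_one_neg, conjLIE_apply]⟩
  · exact ⟨conjLIE.trans (LinearIsometryEquiv.neg ℝ), fun z => by
      rw [prop12vii_signC_neg_one, LinearIsometryEquiv.trans_apply, LinearIsometryEquiv.coe_neg, conjLIE_apply]⟩
  · exact ⟨LinearIsometryEquiv.neg ℝ, fun z => by rw [prop12vii_signC_neg_neg, LinearIsometryEquiv.coe_neg]⟩

/-- **IUTchIII:Prop1.2(vii)** (kurims p.33) every sign map preserves the absolute value `|·|` of `k = ℂ`.
[claim: Mochizuki2012, status: disputed] -/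
theorem prop12vii_signC_norm (u v : ℤˣ) (z : ℂ) : ‖(⟨u • z.re, v • z.im⟩ : ℂ)‖ = ‖z‖ := by
  obtain ⟨e, he⟩ := prop12vii_signC_exists_linearIsometryEquiv u v
  rw [← he, e.norm_map]

/-- **IUTchIII:Prop1.2(vii)** (kurims p.33) every sign map is continuous (an isomorphism of TOPOLOGICAL modules).
[claim: Mochizuki2012, status: disputed] -/
theorem prop12vii_signC_continuous (u v : ℤˣ) : Continuous fun z : ℂ => (⟨u • z.re, v • z.im⟩ : ℂ) := by
  obtain ⟨e, he⟩ := prop12vii_signC_exists_linearIsometryEquiv u v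
  simpa only [← he] using e.continuous

/-- **IUTchIII:Prop1.2(vii)** (kurims p.33) a norm-preserving involution maps every subset of `k` cut out by a
condition on `|·|` onto itself (used for `I_k`, `O_k`, `O_k^×`). [claim: Mochizuki2012, status: disputed] -/
theorem prop12vii_signC_image_setOf_norm (u v : ℤˣ) (p : ℝ → Prop) :
    (fun z : ℂ => (⟨u • z.re, v • z.im⟩ : ℂ)) '' {z | p ‖z‖} = {z | p ‖z‖} := by
  apply Set.Subset.antisymm
  · rintro _ ⟨z, hz, rfl⟩
    simpa only [Set.mem_setOf_eq, prop12vii_signC_norm] using hz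
  · intro z hz
    refine ⟨⟨u • z.re, v • z.im⟩, ?_, prop12vii_signC_involutive u v z⟩
    simpa only [Set.mem_setOf_eq, prop12vii_signC_norm] using hz

/-- **IUTchIII:Prop1.2(vii)** (kurims p.33) "compatible with … the respective log-shells": every sign map maps the
archimedean log-shell `I_k = {|a| ≤ π}` (`arcLogShell`, Rmk 1.2.2 (ii)) onto itself. [claim: Mochizuki2012, status: disputed] -/
theorem prop12vii_signC_image_arcLogShell (u v : ℤˣ) :
    (fun z : ℂ => (⟨u • z.re, v • z.im⟩ : ℂ)) '' arcLogShell = arcLogShell :=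
  prop12vii_signC_image_setOf_norm u v (· ≤ Real.pi)

/-- **IUTchIII:Prop1.2(vii)** (kurims p.33) the same for the [AbsTopIII] Prop 5.8 (v) log-shell `ℐ(G)` read in the
`ℂ`-model (`ComplexLogShell.logShell`, the closed disc of radius `π`). [claim: Mochizuki2012, status: disputed] -/
theorem prop12vii_signC_image_complexLogShell (u v : ℤˣ) :
    (fun z : ℂ => (⟨u • z.re, v • z.im⟩ : ℂ)) '' ComplexLogShell.logShell = ComplexLogShell.logShell := by
  rw [← arcLogShell_eq_complexLogShell]
  exact prop12vii_signC_image_arcLogShell u v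

/-- **IUTchIII:Prop1.2(vii)** (kurims p.33) every sign map maps the units `O_k^× = {|a| = 1}` (`arcUnits`) onto
themselves. [claim: Mochizuki2012, status: disputed] -/
theorem prop12vii_signC_image_arcUnits (u v : ℤˣ) :
    (fun z : ℂ => (⟨u • z.re, v • z.im⟩ : ℂ)) '' arcUnits = arcUnits :=
  prop12vii_signC_image_setOf_norm u v (· = 1)

/-- **IUTchIII:Prop1.2(vii)** (kurims p.33) every sign map maps `O_k = {|a| ≤ 1}` (`arcIntegers`) onto itself.
[claim: Mochizuki2012, status: disputed] -/
theorem prop12vii_signC_image_arcIntegers (u v : ℤˣ) :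
    (fun z : ℂ => (⟨u • z.re, v • z.im⟩ : ℂ)) '' arcIntegers = arcIntegers :=
  prop12vii_signC_image_setOf_norm u v (· ≤ 1)

/-- **IUTchIII:Prop1.2(vii)** (kurims p.33; [AbsTopIII] Prop 5.8 (vi) p.141) every sign map maps
`𝒪^×_{k~(G)}` read in the `ℂ`-model (`ComplexLogShell.units`, the unit circle) onto itself.
[claim: Mochizuki2012, status: disputed] -/
theorem prop12vii_signC_image_complexUnits (u v : ℤˣ) :
    (fun z : ℂ => (⟨u • z.re, v • z.im⟩ : ℂ)) '' ComplexLogShell.units = ComplexLogShell.units := by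
  have h : ComplexLogShell.units = {z : ℂ | ‖z‖ = 1} := by
    rw [ComplexLogShell.units_eq_sphere]
    exact Set.ext fun z => mem_sphere_zero_iff_norm
  rw [h]
  exact prop12vii_signC_image_setOf_norm u v (· = 1)

/-! #### Radial log-volumes ([AbsTopIII] Prop 5.7 (ii): `μ_k(A)` = length of `pr_ℝ(A) = |·|(A)`) -/

/-- **IUTchIII:Prop1.2(vii)** (kurims p.33) a sign map does not change the radial projection `pr_ℝ(A) = |·|(A)`
of any `A ⊆ k`. [claim: Mochizuki2012, status: disputed] -/
theorem prop12vii_signC_norm_image (u v : ℤˣ) (S : Set ℂ) :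
    (‖·‖) '' ((fun z : ℂ => (⟨u • z.re, v • z.im⟩ : ℂ)) '' S) = (‖·‖) '' S := by
  rw [Set.image_image]
  simp only [prop12vii_signC_norm]

/-- **IUTchIII:Prop1.2(vii)** (kurims p.33) "compatible with … the respective … radial log-volumes": every sign map
preserves the radial volume `μ_k(A)` of EVERY `A ⊆ k`. [claim: Mochizuki2012, status: disputed] -/
theorem prop12vii_signC_radialVolume (u v : ℤˣ) (S : Set ℂ) :
    ComplexVolume.radialVolume ((fun z : ℂ => (⟨u • z.re, v • z.im⟩ : ℂ)) '' S) =
      ComplexVolume.radialVolume S := by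
  rw [ComplexVolume.radialVolume, ComplexVolume.radialVolume, prop12vii_signC_norm_image]

/-- **IUTchIII:Prop1.2(vii)** (kurims p.33) … hence the radial log-volume `μ_k^log(A)` of every `A ⊆ k`.
[claim: Mochizuki2012, status: disputed] -/
theorem prop12vii_signC_radialLogVolume (u v : ℤˣ) (S : Set ℂ) :
    ComplexVolume.radialLogVolume ((fun z : ℂ => (⟨u • z.re, v • z.im⟩ : ℂ)) '' S) =
      ComplexVolume.radialLogVolume S := by
  rw [ComplexVolume.radialLogVolume, ComplexVolume.radialLogVolume, prop12vii_signC_radialVolume]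

/-- **IUTchIII:Prop1.2(vii)** (kurims p.33) every sign map preserves the domain `M(k)` of the radial volume
(nonempty compact sets whose radial projection is the closure of its interior). [claim: Mochizuki2012, status: disputed] -/
theorem prop12vii_signC_mem_radialAdmissible (u v : ℤˣ) {S : Set ℂ} (hS : S ∈ ComplexVolume.radialAdmissible) :
    (fun z : ℂ => (⟨u • z.re, v • z.im⟩ : ℂ)) '' S ∈ ComplexVolume.radialAdmissible := by
  refine ⟨hS.1.image _, hS.2.1.image (prop12vii_signC_continuous u v), ?_⟩
  rw [prop12vii_signC_norm_image]
  exact hS.2.2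

/-! #### Angular log-volumes ([AbsTopIII] Prop 5.7 (ii): `μ̆_k(A)` = arc length of the image of `A` in `𝒪_k^× = ℝ/2πℤ`) -/

/-- **IUTchIII:Prop1.2(vii)** (kurims p.33) complex conjugation REFLECTS the angular projection:
`phase(z̄) = -phase(z)` in `ℝ/2πℤ` (for every `z`). [claim: Mochizuki2012, status: disputed] -/
theorem prop12vii_phase_conj (z : ℂ) : ComplexVolume.phase (conj z) = -ComplexVolume.phase z :=
  Complex.arg_conj_coe_angle z

/-- **IUTchIII:Prop1.2(vii)** (kurims p.33) the angular projection of `Ā` is the reflection of that of `A`.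
[claim: Mochizuki2012, status: disputed] -/
theorem prop12vii_phase_image_conj (S : Set ℂ) :
    ComplexVolume.phase '' ((fun z : ℂ => conj z) '' S) = -(ComplexVolume.phase '' S) := by
  rw [Set.image_image, ← Set.image_neg_eq_neg, Set.image_image]
  simp only [prop12vii_phase_conj]

/-- **IUTchIII:Prop1.2(vii)** (kurims p.33) complex conjugation preserves the angular volume `μ̆_k(A)` of EVERY
`A ⊆ k` — reflection invariance of arc length on `S¹` (negation invariance of the Haar measure of `ℝ/2πℤ`).
[claim: Mochizuki2012, status: disputed] -/
theorem prop12vii_angularVolume_conj (S : Set ℂ) :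
    ComplexVolume.angularVolume ((fun z : ℂ => conj z) '' S) = ComplexVolume.angularVolume S := by
  have hT : Fact (0 < 2 * Real.pi) := ⟨Real.two_pi_pos⟩
  rw [ComplexVolume.angularVolume, ComplexVolume.angularVolume, prop12vii_phase_image_conj,
    Measure.measure_neg]

/-- **IUTchIII:Prop1.2(vii)** (kurims p.33) `z ↦ -z` is multiplication by `-1 ∈ 𝒪_k^×`.
[claim: Mochizuki2012, status: disputed] -/
theorem prop12vii_neg_image_eq_smul (S : Set ℂ) : (fun z : ℂ => -z) '' S = (-1 : ℂ) • S := by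
  ext w
  simp only [Set.mem_image, Set.mem_smul_set, smul_eq_mul, neg_one_mul]

/-- **IUTchIII:Prop1.2(vii)** (kurims p.33) `z ↦ -z` preserves the angular volume `μ̆_k(A)` of every `A ⊆ k^×` —
rotation (by `π`) invariance of arc length ([AbsTopIII] Prop 5.7 (ii)(b), `ComplexVolume.angularVolume_smul`).
[claim: Mochizuki2012, status: disputed] -/
theorem prop12vii_angularVolume_neg {S : Set ℂ} (hS : S ⊆ {0}ᶜ) :
    ComplexVolume.angularVolume ((fun z : ℂ => -z) '' S) = ComplexVolume.angularVolume S := by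
  rw [prop12vii_neg_image_eq_smul]
  exact ComplexVolume.angularVolume_smul (neg_ne_zero.mpr one_ne_zero) hS

/-- **IUTchIII:Prop1.2(vii)** (kurims p.33) "compatible with … the respective angular … log-volumes": every sign
map preserves the angular volume `μ̆_k(A)` of EVERY `A ⊆ k^×` (the domain `M̆(k)` consists of subsets of `k^×`).
[claim: Mochizuki2012, status: disputed] -/
theorem prop12vii_signC_angularVolume (u v : ℤˣ) {S : Set ℂ} (hS : S ⊆ {0}ᶜ) :
    ComplexVolume.angularVolume ((fun z : ℂ => (⟨u • z.re, v • z.im⟩ : ℂ)) '' S) =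
      ComplexVolume.angularVolume S := by
  rcases Int.units_eq_one_or u with rfl | rfl <;> rcases Int.units_eq_one_or v with rfl | rfl
  · simp only [prop12vii_signC_one_one, Set.image_id']
  · simp only [prop12vii_signC_one_neg]
    exact prop12vii_angularVolume_conj S
  · simp only [prop12vii_signC_neg_one]
    have hS' : (fun z : ℂ => conj z) '' S ⊆ {0}ᶜ := by
      rintro _ ⟨z, hz, rfl⟩
      exact (map_ne_zero_iff (starRingEnd ℂ) (RingHom.injective _)).mpr (hS hz)
    rw [← Set.image_image (fun z : ℂ => -z) (fun z : ℂ => conj z), prop12vii_angularVolume_neg hS',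
      prop12vii_angularVolume_conj]
  · simp only [prop12vii_signC_neg_neg]
    exact prop12vii_angularVolume_neg hS

/-- **IUTchIII:Prop1.2(vii)** (kurims p.33) … hence the angular log-volume `μ̆_k^log(A)` of every `A ⊆ k^×`.
[claim: Mochizuki2012, status: disputed] -/
theorem prop12vii_signC_angularLogVolume (u v : ℤˣ) {S : Set ℂ} (hS : S ⊆ {0}ᶜ) :
    ComplexVolume.angularLogVolume ((fun z : ℂ => (⟨u • z.re, v • z.im⟩ : ℂ)) '' S) =
      ComplexVolume.angularLogVolume S := by
  rw [ComplexVolume.angularLogVolume, ComplexVolume.angularLogVolume, prop12vii_signC_angularVolume u v hS]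

/-! #### Metrics ([IUTchIII] Rmk 1.2.1 (ii), `ArchimedeanMetrics.lean`) -/

/-- **IUTchIII:Prop1.2(vii)** (kurims p.33; Rmk 1.2.1 (ii) p.35) every sign map preserves every "metric on `k`"
(translation-invariant Riemannian metric compatible with the almost complex structures — the metrics whose
integrals give the angular and radial log-volumes): `g(σz, σw) = g(z, w)`. [claim: Mochizuki2012, status: disputed] -/
theorem prop12vii_signC_metric (g : Metric) (u v : ℤˣ) (z w : ℂ) :
    g.B ⟨u • z.re, v • z.im⟩ ⟨u • w.re, v • w.im⟩ = g.B z w := by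
  rw [g.apply_eq, g.apply_eq z w]
  congr 1
  rcases Int.units_eq_one_or u with rfl | rfl <;> rcases Int.units_eq_one_or v with rfl | rfl <;>
    simp [Complex.mul_re]

end Model

end Literature.IUT.LogThetaLattice
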